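import Summits.AtomisticToContinuum.HydrodynamicLimit.Theorems.CollisionIsometryCLTDiffuseBackwardInfluenceShareLD
import Summits.AtomisticToContinuum.HydrodynamicLimit.Theorems.CollisionIsometryCLTDiffuseBackwardInfluenceShareLDGeometry
import Summits.AtomisticToContinuum.HydrodynamicLimit.Theorems.CollisionIsometryCLTDiffuseBackwardInfluenceLateMergesRare
import HarnessLib

/-!
# `DiffuseBackwardInfluence`, line `share-nondegeneracy-one-flight`, stub `stub_oneFlightShareLD`:
the pathwise bridge to the cap/band geometry and the DIRECTIONAL form of the lever

Crux `stmt-AtomisticToContinuum-12950` (`CollisionIsometryCLT.DiffuseBackwardInfluence`). The registered stub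
`stub_oneFlightShareLD` (`∃ σ₀, ∀ σ < σ₀, ∀ θ > 0, …, ShareLDAt σ θ δ h η Φ`) is, after the landed reduction
`shareLD_of_shareSetLD`, the open named conjecture `ShareLD.ShareSetLD σ θ` (prescribed-set joint share-degeneracy
large deviation under the invariant law). This support file (wave-1 worker of the continuation lead) does NOT close it.
It lands what a future proof of `ShareSetLD` consumes and isolates the dynamical content in its natural form:

* §1 AUDIT, pathwise: at every fold step that reflects a pair, the realised normal IS a diameter vector,
  `‖normalAt‖ = ε_N` (`ShareLD.norm_normalAt_of_nonempty`: the reflected pair `h.some` lies in the contact set), so for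
  `σ > 0` the realised unit normal of every touching step is a unit vector (`ShareLD.norm_unitNormal_of_touches`) — the
  junk branch `unitNormal = 0` (which would make every positive-mass block `Degenerate`) is never taken at a scoring
  step, for EVERY configuration (not only almost surely).
* §2 FROZEN BLOCKS: the blocks of particle `i` read at its first collision of the slot are its blocks at the slot
  boundary (`ShareLD.blockCol_find_eq`): the bad set of normals below is determined at the slot boundary.
* §3 THE BRIDGE (definitional): `Degenerate η (blockMass n i k) (blockShare n i k ω) ↔ ω ∈ ShareLD.degDir η (blockCol n i k)`
  for `ω ∈ S²` (`Iff.rfl`), hence `degScore` is the weighted indicator score of the geometry file evaluated at the realised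
  unit normal (`ShareLD.degScore_eq_indicator_sum`), and for EVERY configuration, step and particle the set of unit normals
  that would make the score `≥ δ` is an `O(√η/δ)` fraction of `S²` (`ShareLD.volume_toSphere_badDir_le`, row budget
  `stub_rowBudgetN` + `volume_toSphere_weightedDeg_le`).
* §4 THE DIRECTIONAL ENVELOPE: an `η`-degenerate share along `ω` (`‖ω‖ ≤ 1`) of a nonzero block puts `ω` in
  `ShareLD.nearDir √(3η)` of the block — squared cosine to the LONGEST column `< 3η` (band) or `> 1 − 3η` (two caps)
  (`ShareLD.mem_nearDir_of_degenerate`, the landed pigeonhole lemmas); `ShareLD.nearScore α` is the corresponding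
  tracer-mass-weighted score and `degScore η ≤ nearScore √(3η)` pointwise (`ShareLD.degScore_le_nearScore`).
* §5 `ShareLD.NearSetLD σ θ` (`@[conjecture]`): the prescribed-set DIRECTIONAL large deviation with the power rate
  `(K α / δ)^{|A|/2}` — the exact output form of the one-flight sequential argument (each of the `≥ |A|/2` distinct
  scoring collisions puts its unit normal in a union of `≤ 3(N+1)` weighted bands/caps of angular size `α` fixed by the
  particle's blocks at the slot boundary; conditional Markov over sources). REGISTERED SUB-GOAL
  `shareSetLD_of_nearSetLD : NearSetLD σ θ → ShareSetLD σ θ` (set inclusion + `α := √(3η)`, `η₀ := min (1/3) (c²/3)`,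
  `c := δ e^{−2h/δ}/K`; no measurability needed).

AUDIT VERDICT on the stub (heuristics; numbers in the worker's reply): no cheap kill. (i) exact share degeneracy needs the
normal in a block-determined proper subspace — Lebesgue-null per particle; the one mechanism found that concentrates a
first-collision normal near a block-determined direction is the PROMPT RE-COLLISION of the same pair after a third-body
kick within time `≲ α ε_N/√θ` (probability `≍ σ³ α`, LINEAR in the angle `α`): its normal is exactly degenerate in the
limit (`step_step`), so the conditional law of the next normal given the past has a `1/angle` singularity at the previous
normal — an `L^∞` density bound `K(σ)` w.r.t. surface measure (the wording of the docstring of `ShareSetLD`) is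
heuristically false (`P(cap of radius α) ≍ σ³α ≫ α²/4`), while the band/cap form `P(α-neighbourhood) ≤ K α` that `NearSetLD`
encodes is consistent with it; (ii) `Nat.find` reads the first touching step of the slot, massless blocks carry weight `0`,
idle particles score `0`, `unitNormal ≠ 0` pathwise (§1); (iii) every structure examined (prompt rings, tight cages with
gap `√η ε_N`, planar sheets) costs `≥ c · log(1/η)` nats per degenerate particle, consistent with `∀ h ∃ η₀`.
-/

namespace Summit.AtomisticToContinuum.HydrodynamicLimit.Theorems.DiffuseBackwardInfluenceShare

open scoped BigOperators Topology ENNReal InnerProductSpace Classical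
open Filter Set MeasureTheory
open Literature.Analysis.FluidPDE
open Literature.MathematicalPhysics.KineticTheory (hsDiameter hsDiameter_pos)
open Summit.AtomisticToContinuum.HydrodynamicLimit.Theorems.DiffuseBackwardInfluenceNeg

noncomputable section

namespace ShareLD

variable {σ : ℝ} {N : ℕ}

/-! ## §1 The realised normal of a reflecting step is a diameter vector (pathwise) -/

/-- At a fold step that reflects a pair, the realised normal has norm EXACTLY `ε_N = hsDiameter σ N`: the reflected
pair `h.some` is an incoming CONTACT pair of the pre-collisional configuration. [folklore] -/
theorem norm_normalAt_of_nonempty {y : Cfg N} {k : ℕ} (h : (pairsAt σ N y k).Nonempty) :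
    ‖normalAt σ N y k‖ = hsDiameter σ N := by
  unfold normalAt
  rw [dif_pos h]
  exact (Alexander.mem_incomingPairs.1 h.some_mem).2.1.2

/-- For `σ > 0` the realised normal of a reflecting step is nonzero. [folklore] -/
theorem normalAt_ne_zero_of_nonempty (hσ : 0 < σ) {y : Cfg N} {k : ℕ} (h : (pairsAt σ N y k).Nonempty) :
    normalAt σ N y k ≠ 0 := by
  intro h0
  have h1 := norm_normalAt_of_nonempty h
  rw [h0, norm_zero] at h1
  exact (hsDiameter_pos hσ N).ne h1

/-- For `σ > 0` the realised UNIT normal of a reflecting step is a unit vector. [folklore] -/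
theorem norm_unitNormal_of_nonempty (hσ : 0 < σ) {y : Cfg N} {k : ℕ} (h : (pairsAt σ N y k).Nonempty) :
    ‖unitNormal σ N y k‖ = 1 := by
  unfold unitNormal
  exact norm_smul_inv_norm (normalAt_ne_zero_of_nonempty hσ h)

/-- For `σ > 0` the realised unit normal of a step touching some particle is a unit vector: the junk branch
`unitNormal = 0` is never taken at a scoring step. [folklore] -/
theorem norm_unitNormal_of_touches (hσ : 0 < σ) {y : Cfg N} {k : ℕ} {i : Fin (N + 1)} (h : Touches σ N y k i) :
    ‖unitNormal σ N y k‖ = 1 := by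
  obtain ⟨hne, -⟩ := h
  exact norm_unitNormal_of_nonempty hσ hne

/-! ## §2 Blocks are frozen while the particle is untouched -/

/-- If no fold step with index in `[m, n)` touches particle `i`, its block columns at `n` are those at `m`. [folklore] -/
theorem blockCol_eq_of_forall_not_touches {y : Cfg N} {i : Fin (N + 1)} {m n : ℕ} (hmn : m ≤ n)
    (h : ∀ c, m ≤ c → c < n → ¬ Touches σ N y c i) (k : Fin (N + 1)) (a : Fin 3) :
    blockCol σ N y n i k a = blockCol σ N y m i k a := by
  induction n, hmn using Nat.le_induction with
  | base => rfl
  | succ n hmn ih =>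
    have hn : ¬ Touches σ N y n i := h n hmn (Nat.lt_succ_self n)
    have hne : ∀ h' : (pairsAt σ N y n).Nonempty, i ≠ h'.some.1 ∧ i ≠ h'.some.2 := by
      intro h'
      simp only [Touches, not_exists, not_or] at hn
      exact ⟨fun e => (hn h').1 e.symm, fun e => (hn h').2 e.symm⟩
    rw [OnePath.blockCol_succ_of_ne hne k a, ih (fun c hc hcn => h c hc (Nat.lt_succ_of_lt hcn))]

/-- FROZEN BLOCKS: the block columns of particle `i` read at its FIRST collision of slot `r` are its block columns at
the slot boundary `slotStart r`. [folklore] -/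
theorem blockCol_find_eq {y : Cfg N} {Δ : ℝ} {S r : ℕ} {i : Fin (N + 1)} (h : HasCollIn σ N y Δ S r i)
    (k : Fin (N + 1)) (a : Fin 3) :
    blockCol σ N y (Nat.find h) i k a = blockCol σ N y (slotStart σ N y Δ S r) i k a := by
  have hspec := Nat.find_spec h
  refine blockCol_eq_of_forall_not_touches hspec.1 (fun c hc hcn ht => ?_) k a
  exact Nat.find_min h hcn ⟨hc, hcn.trans hspec.2.1, ht⟩

/-- Frozen block masses (same statement for `blockMass`). [folklore] -/
theorem blockMass_find_eq {y : Cfg N} {Δ : ℝ} {S r : ℕ} {i : Fin (N + 1)} (h : HasCollIn σ N y Δ S r i)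
    (k : Fin (N + 1)) :
    blockMass σ N y (Nat.find h) i k = blockMass σ N y (slotStart σ N y Δ S r) i k := by
  unfold blockMass
  simp only [blockCol_find_eq h]

/-- Frozen block shares (same statement for `blockShare`, along any vector). [folklore] -/
theorem blockShare_find_eq {y : Cfg N} {Δ : ℝ} {S r : ℕ} {i : Fin (N + 1)} (h : HasCollIn σ N y Δ S r i)
    (k : Fin (N + 1)) (ω : V3) :
    blockShare σ N y (Nat.find h) i k ω = blockShare σ N y (slotStart σ N y Δ S r) i k ω := by
  unfold blockShare
  simp only [blockCol_find_eq h]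

/-! ## §3 The bridge to the cap/band geometry -/

/-- THE BRIDGE (definitional): a block is `η`-share-degenerate along a unit vector `ω` iff `ω` lies in the degenerate
direction set `degDir` of its columns. [folklore] -/
theorem degenerate_iff_mem_degDir (y : Cfg N) (n : ℕ) (i k : Fin (N + 1)) (η : ℝ)
    (ω : Metric.sphere (0 : V3) 1) :
    Degenerate η (blockMass σ N y n i k) (blockShare σ N y n i k ω) ↔ ω ∈ degDir η (blockCol σ N y n i k) :=
  Iff.rfl

/-- `degScore` IS the weighted indicator score of the geometry file (weights `a_ik/3`, blocks and normal read at the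
first collision `Nat.find h` of the slot), evaluated at the realised unit normal seen as a point of `S²`. [folklore] -/
theorem degScore_eq_indicator_sum {y : Cfg N} {Δ : ℝ} {S r : ℕ} {η : ℝ} {i : Fin (N + 1)}
    (h : HasCollIn σ N y Δ S r i) (ω : Metric.sphere (0 : V3) 1)
    (hω : (ω : V3) = unitNormal σ N y (Nat.find h)) :
    degScore σ N y Δ S r η i = ∑ k : Fin (N + 1), blockMass σ N y (Nat.find h) i k / 3 *
      (degDir η (blockCol σ N y (Nat.find h) i k)).indicator (fun _ => (1 : ℝ)) ω := by
  unfold degScore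
  rw [dif_pos h]
  refine Finset.sum_congr rfl fun k _ => ?_
  congr 1
  rw [← hω]
  by_cases hd : Degenerate η (blockMass σ N y (Nat.find h) i k) (blockShare σ N y (Nat.find h) i k ω)
  · rw [if_pos hd, Set.indicator_of_mem ((degenerate_iff_mem_degDir y _ i k η ω).1 hd)]
  · rw [if_neg hd, Set.indicator_of_notMem (mt (degenerate_iff_mem_degDir y _ i k η ω).2 hd)]

/-- A score `≥ δ > 0` means (for `σ > 0`): the particle collides in the slot and the realised unit normal of its first
collision is a point of `S²` lying in the bad set `{ω | δ ≤ Σ_k (a_ik/3)·1[ω ∈ degDir η (M_ik)]}` of its frozen blocks.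
[folklore] -/
theorem exists_sphere_of_le_degScore (hσ : 0 < σ) {y : Cfg N} {Δ : ℝ} {S r : ℕ} {η δ : ℝ} {i : Fin (N + 1)}
    (hδ : 0 < δ) (hle : δ ≤ degScore σ N y Δ S r η i) :
    ∃ h : HasCollIn σ N y Δ S r i, ∃ ω : Metric.sphere (0 : V3) 1,
      (ω : V3) = unitNormal σ N y (Nat.find h) ∧
        δ ≤ ∑ k : Fin (N + 1), blockMass σ N y (Nat.find h) i k / 3 *
          (degDir η (blockCol σ N y (Nat.find h) i k)).indicator (fun _ => (1 : ℝ)) ω := by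
  by_cases h : HasCollIn σ N y Δ S r i
  · have h1 : ‖unitNormal σ N y (Nat.find h)‖ = 1 := norm_unitNormal_of_touches hσ (Nat.find_spec h).2.2
    refine ⟨h, ⟨unitNormal σ N y (Nat.find h), mem_sphere_zero_iff_norm.2 h1⟩, rfl, ?_⟩
    rwa [← degScore_eq_indicator_sum h _ rfl]
  · exfalso
    have : degScore σ N y Δ S r η i = 0 := by unfold degScore; rw [dif_neg h]
    linarith

/-- **THE BAD SET OF NORMALS IS AN `O(√η/δ)` FRACTION OF THE SPHERE, FOR EVERY CONFIGURATION, STEP AND PARTICLE**: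
the set of unit normals `ω` for which the tracer-mass-weighted degeneracy score `Σ_k (a_ik(n)/3)·1[ω ∈ degDir η (M_ik(n))]`
is `≥ δ` has surface measure `≤ δ⁻¹ · 2 · (3·2⁶·√(3η)) · |B₁|` (row budget `Σ_k a_ik = 3`, so the weights sum to `1`;
massless blocks carry weight `0`). [folklore] -/
theorem volume_toSphere_badDir_le {η δ : ℝ} (hη : 0 < η) (hδ : 0 < δ) (σ : ℝ) (N : ℕ) (y : Cfg N) (n : ℕ)
    (i : Fin (N + 1)) :
    (volume : Measure V3).toSphere {ω | δ ≤ ∑ k : Fin (N + 1), blockMass σ N y n i k / 3 *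
        (degDir η (blockCol σ N y n i k)).indicator (fun _ => (1 : ℝ)) ω} ≤
      ENNReal.ofReal δ⁻¹ * (2 * (ENNReal.ofReal (3 * (2 ^ 6 * Real.sqrt (3 * η))) *
        volume (Metric.ball (0 : V3) 1))) := by
  refine volume_toSphere_weightedDeg_le η δ hη hδ (N + 1) (fun k => blockCol σ N y n i k)
    (fun k => blockMass σ N y n i k / 3) (fun k => div_nonneg (blockMass_nonneg σ N y n i k) (by norm_num)) ?_ ?_
  · rw [← Finset.sum_div, stub_rowBudgetN σ N y n i]
    norm_num
  · intro k hk
    have h0 : ∀ a, blockCol σ N y n i k a = 0 := fun a => congrFun hk a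
    simp [blockMass, h0]

/-! ## §4 The directional envelope of share degeneracy -/

/-- The DIRECTIONAL ENVELOPE of `η`-degeneracy at angular size `α`: vectors whose squared cosine to the direction of a
LONGEST column of the block is `< α²` (equatorial band) or `> 1 − α²` (two polar caps). Only the longest column's
direction — one past-determined unit vector per block — enters. -/
def nearDir (α : ℝ) (u : Fin 3 → V3) : Set V3 :=
  {ω | ∃ a : Fin 3, (∀ b, ‖u b‖ ≤ ‖u a‖) ∧
    (⟪ω, ‖u a‖⁻¹ • u a⟫_ℝ ^ 2 < α ^ 2 ∨ 1 - α ^ 2 < ⟪ω, ‖u a‖⁻¹ • u a⟫_ℝ ^ 2)}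

/-- PIGEONHOLE: an `η`-degenerate share along `ω` (`‖ω‖ ≤ 1`) of a NONZERO block puts `ω` in `nearDir √(3η)` of the block
(`inner_sq_lt_of_share_lt` / `inner_sq_gt_of_share_gt` of the geometry file). [folklore] -/
theorem mem_nearDir_of_degenerate {u : Fin 3 → V3} (hu : u ≠ 0) {ω : V3} (hω : ‖ω‖ ≤ 1) {η : ℝ} (hη : 0 ≤ η)
    (hd : Degenerate η (∑ a, ‖u a‖ ^ 2) (∑ a, ⟪ω, u a⟫_ℝ ^ 2)) : ω ∈ nearDir (Real.sqrt (3 * η)) u := by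
  obtain ⟨a₀, -, hmax⟩ := Finset.exists_max_image Finset.univ (fun a => ‖u a‖) Finset.univ_nonempty
  have hmax' : ∀ b, ‖u b‖ ≤ ‖u a₀‖ := fun b => hmax b (Finset.mem_univ b)
  have h0 : u a₀ ≠ 0 := by
    intro hz
    apply hu
    funext a
    have : ‖u a‖ ≤ 0 := by simpa [hz] using hmax' a
    exact norm_le_zero_iff.1 this
  have hn : 0 < ‖u a₀‖ := norm_pos_iff.2 h0
  have hsq : Real.sqrt (3 * η) ^ 2 = 3 * η := Real.sq_sqrt (by positivity)
  have hsc : ⟪ω, ‖u a₀‖⁻¹ • u a₀⟫_ℝ ^ 2 = ⟪ω, u a₀⟫_ℝ ^ 2 / ‖u a₀‖ ^ 2 := by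
    rw [real_inner_smul_right, mul_pow, inv_pow, div_eq_inv_mul]
  refine ⟨a₀, hmax', ?_⟩
  rw [hsq, hsc]
  rcases hd with hlow | hhigh
  · left
    have h1 := inner_sq_lt_of_share_lt u ω hη a₀ hmax' hlow
    rw [div_lt_iff₀ (by positivity)]
    linarith
  · right
    have h1 := inner_sq_gt_of_share_gt u hω hη a₀ hmax' hhigh
    rw [lt_div_iff₀ (by positivity)]
    linarith

variable (σ N) in
/-- The DIRECTIONAL SCORE of particle `i` on slot `r` at angular size `α`: if `i` collides in the slot, the
tracer-mass-weighted (`a_ik/3`) indicator that the realised unit normal of its FIRST collision of the slot lies in the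
directional envelope `nearDir α` of the block `(i, k)` (blocks read at that collision = at the slot boundary); `0` if
`i` is idle on the slot. -/
def nearScore (y : Cfg N) (Δ : ℝ) (S r : ℕ) (α : ℝ) (i : Fin (N + 1)) : ℝ :=
  if h : HasCollIn σ N y Δ S r i then
    ∑ k : Fin (N + 1), blockMass σ N y (Nat.find h) i k / 3 *
      (if unitNormal σ N y (Nat.find h) ∈ nearDir α (blockCol σ N y (Nat.find h) i k) then 1 else 0)
  else 0

/-- **`degScore η ≤ nearScore √(3η)` pointwise**: share degeneracy implies directional nearness, block by block
(massless blocks contribute `0` on both sides). [folklore] -/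
theorem degScore_le_nearScore {η : ℝ} (hη : 0 ≤ η) (y : Cfg N) (Δ : ℝ) (S r : ℕ) (i : Fin (N + 1)) :
    degScore σ N y Δ S r η i ≤ nearScore σ N y Δ S r (Real.sqrt (3 * η)) i := by
  unfold degScore nearScore
  by_cases h : HasCollIn σ N y Δ S r i
  · rw [dif_pos h, dif_pos h]
    refine Finset.sum_le_sum fun k _ => ?_
    have h3 : 0 ≤ blockMass σ N y (Nat.find h) i k / 3 :=
      div_nonneg (blockMass_nonneg σ N y _ i k) (by norm_num)
    by_cases hd : Degenerate η (blockMass σ N y (Nat.find h) i k)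
        (blockShare σ N y (Nat.find h) i k (unitNormal σ N y (Nat.find h)))
    · rw [if_pos hd, mul_one]
      by_cases hz : blockCol σ N y (Nat.find h) i k = 0
      · have h0 : ∀ a, blockCol σ N y (Nat.find h) i k a = 0 := fun a => congrFun hz a
        have hm : blockMass σ N y (Nat.find h) i k = 0 := by simp [blockMass, h0]
        rw [hm, zero_div, zero_mul]
      · rw [if_pos (mem_nearDir_of_degenerate hz (LateMerges.norm_unitNormal_le_one y _) hη hd), mul_one]
    · rw [if_neg hd, mul_zero]
      exact mul_nonneg h3 (by split_ifs <;> norm_num)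
  · rw [dif_neg h, dif_neg h]

/-- `0 ≤ nearScore`. [folklore] -/
theorem nearScore_nonneg (y : Cfg N) (Δ : ℝ) (S r : ℕ) (α : ℝ) (i : Fin (N + 1)) :
    0 ≤ nearScore σ N y Δ S r α i := by
  unfold nearScore
  by_cases h : HasCollIn σ N y Δ S r i
  · rw [dif_pos h]
    refine Finset.sum_nonneg fun k _ => mul_nonneg ?_ (by split_ifs <;> norm_num)
    exact div_nonneg (blockMass_nonneg σ N y _ i k) (by norm_num)
  · rw [dif_neg h]

/-- `nearScore ≤ 1` (row budget). [folklore] -/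
theorem nearScore_le_one (y : Cfg N) (Δ : ℝ) (S r : ℕ) (α : ℝ) (i : Fin (N + 1)) :
    nearScore σ N y Δ S r α i ≤ 1 := by
  unfold nearScore
  by_cases h : HasCollIn σ N y Δ S r i
  · rw [dif_pos h]
    calc ∑ k, blockMass σ N y (Nat.find h) i k / 3 *
          (if unitNormal σ N y (Nat.find h) ∈ nearDir α (blockCol σ N y (Nat.find h) i k) then (1 : ℝ) else 0)
        ≤ ∑ k, blockMass σ N y (Nat.find h) i k / 3 := by
          refine Finset.sum_le_sum fun k _ => ?_
          have h3 : 0 ≤ blockMass σ N y (Nat.find h) i k / 3 :=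
            div_nonneg (blockMass_nonneg σ N y _ i k) (by norm_num)
          split_ifs
          · rw [mul_one]
          · rw [mul_zero]; exact h3
      _ = 1 := by rw [← Finset.sum_div, stub_rowBudgetN σ N y (Nat.find h) i]; norm_num
  · rw [dif_neg h]
    exact zero_le_one

/-! ## §5 The directional prescribed-set large deviation and the reduction of `ShareSetLD` to it -/

/-- **THE PRESCRIBED-SET DIRECTIONAL LARGE DEVIATION** at reduced density `σ` and temperature `θ` — an OPEN named
conjecture of this programme (obligation node), the dynamical content of the lever in the exact form a one-flight
sequential argument produces: there is `K = K(σ, θ)` such that for every fraction `δ > 0` and angular size `α ∈ (0, 1)`,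
every admissible window, every slot `r < S`, eventually in `N`, for every flow `Φ` (dummy) and EVERY index set `A` with
`|A| ≥ δ(N+1)`, the `eqLaw σ θ`-probability that every particle of `A` collides in the slot with directional score
`nearScore α ≥ δ` (the unit normal of its FIRST in-slot collision lies in the `α`-bands/caps of the longest columns of a
tracer-mass `≥ δ` fraction of its blocks at the slot boundary) is `≤ (K α / δ)^{|A|/2}`. Heuristic: along the
time-ordered collisions each of the `≥ |A|/2` distinct scoring collisions has conditional probability `≤ K α / δ`
(Markov over sources; `P(normal in one band/cap of size α | coarse past) ≤ K' α` — the flux-weighted fresh-partner law is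
bounded, shields only remove support, and the prompt re-collision of the same pair contributes `≍ σ³ α`, still linear in
`α`). Sub-exponential prefactors are absorbed by `K` because `|A| ≥ δ(N+1)`. Not in the tree or in print. -/
@[conjecture] def NearSetLD (σ θ : ℝ) : Prop :=
  ∃ K : ℝ, 0 < K ∧ ∀ δ α : ℝ, 0 < δ → 0 < α → α < 1 →
    ∀ Δ : ℕ → ℝ, (∀ N, 0 < Δ N) → Tendsto Δ atTop (𝓝 0) →
      Tendsto (fun N : ℕ => Δ N * ((N + 1 : ℕ) : ℝ) ^ ((1 : ℝ) / 3)) atTop atTop →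
      ∀ S r : ℕ, 1 ≤ S → r < S →
        ∀ᶠ N : ℕ in atTop, ∀ (Φ : Flow σ N) (A : Finset (Fin (N + 1))),
          δ * ((N : ℝ) + 1) ≤ (A.card : ℝ) →
            eqLaw σ θ N Φ {y : Cfg N | ∀ i ∈ A, δ ≤ nearScore σ N y (Δ N) S r α i} ≤
              ENNReal.ofReal ((K * α / δ) ^ ((A.card : ℝ) / 2))

/-- The arithmetic of the reduction: with `b = e^{−2h/δ}` and `|A| ≥ δ(N+1)`, a base `≤ b` raised to `|A|/2` is
`≤ e^{−h(N+1)}`. [folklore] -/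
theorem rpow_half_card_le {x δ h : ℝ} {N card : ℕ} (hx0 : 0 ≤ x) (hδ : 0 < δ) (hh : 0 ≤ h)
    (hx : x ≤ Real.exp (-(2 * h / δ))) (hA : δ * ((N : ℝ) + 1) ≤ (card : ℝ)) :
    x ^ ((card : ℝ) / 2) ≤ Real.exp (-(h * ((N : ℝ) + 1))) := by
  set b : ℝ := Real.exp (-(2 * h / δ)) with hb
  have hb1 : b ≤ 1 := Real.exp_le_one_iff.2 (by rw [neg_nonpos]; positivity)
  have hbpos : 0 < b := Real.exp_pos _
  calc x ^ ((card : ℝ) / 2) ≤ b ^ ((card : ℝ) / 2) := Real.rpow_le_rpow hx0 hx (by positivity)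
    _ ≤ b ^ (δ * ((N : ℝ) + 1) / 2) := Real.rpow_le_rpow_of_exponent_ge hbpos hb1 (by linarith)
    _ = Real.exp (-(h * ((N : ℝ) + 1))) := by
        rw [hb, ← Real.exp_mul]
        congr 1
        field_simp

end ShareLD

/-- **REGISTERED SUB-GOAL — `ShareSetLD` from the directional large deviation.** At every `(σ, θ)`,
`ShareLD.NearSetLD σ θ → ShareLD.ShareSetLD σ θ`: given `δ, h`, take `K` from `NearSetLD`, `c := δ e^{−2h/δ}/K`,
`η₀ := min (1/3) (c²/3)`; for `η < η₀` put `α := √(3η) ∈ (0, 1)`, `α < c`. Pointwise `degScore η ≤ nearScore α`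
(`ShareLD.degScore_le_nearScore`), so `{∀ i ∈ A, δ ≤ degScore} ⊆ {∀ i ∈ A, δ ≤ nearScore α}` (`measure_mono`, no
measurability), and `(K α/δ)^{|A|/2} ≤ (e^{−2h/δ})^{δ(N+1)/2} = e^{−h(N+1)}` for `|A| ≥ δ(N+1)`. [folklore] -/
theorem shareSetLD_of_nearSetLD : ∀ σ θ : ℝ, ShareLD.NearSetLD σ θ → ShareLD.ShareSetLD σ θ := by
  intro σ θ H δ h hδ hh
  obtain ⟨K, hK, H⟩ := H
  set c : ℝ := δ * Real.exp (-(2 * h / δ)) / K with hc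
  have hcpos : 0 < c := by positivity
  refine ⟨min (1 / 3) (c ^ 2 / 3), by positivity, fun η hη hηlt => ?_⟩
  intro Δ hΔp hΔ0 hΔg S r hS hr
  have hη3 : η < 1 / 3 := lt_of_lt_of_le hηlt (min_le_left _ _)
  have hηc : η < c ^ 2 / 3 := lt_of_lt_of_le hηlt (min_le_right _ _)
  set α : ℝ := Real.sqrt (3 * η) with hα
  have hαpos : 0 < α := Real.sqrt_pos.2 (by positivity)
  have hα1 : α < 1 := by
    rw [hα, ← Real.sqrt_one]
    exact Real.sqrt_lt_sqrt (by positivity) (by linarith)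
  have hαc : α < c := by
    calc α = Real.sqrt (3 * η) := rfl
      _ < Real.sqrt (c ^ 2) := Real.sqrt_lt_sqrt (by positivity) (by linarith)
      _ = c := Real.sqrt_sq hcpos.le
  have hbase : K * α / δ ≤ Real.exp (-(2 * h / δ)) := by
    rw [div_le_iff₀ hδ]
    calc K * α ≤ K * c := by gcongr
      _ = Real.exp (-(2 * h / δ)) * δ := by rw [hc]; field_simp
  filter_upwards [H δ α hδ hαpos hα1 Δ hΔp hΔ0 hΔg S r hS hr] with N hN
  intro Φ A hA
  have hsub : {y : Cfg N | ∀ i ∈ A, δ ≤ degScore σ N y (Δ N) S r η i} ⊆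
      {y : Cfg N | ∀ i ∈ A, δ ≤ ShareLD.nearScore σ N y (Δ N) S r α i} :=
    fun y hy i hi => (hy i hi).trans (ShareLD.degScore_le_nearScore hη.le y (Δ N) S r i)
  calc eqLaw σ θ N Φ {y : Cfg N | ∀ i ∈ A, δ ≤ degScore σ N y (Δ N) S r η i}
      ≤ eqLaw σ θ N Φ {y : Cfg N | ∀ i ∈ A, δ ≤ ShareLD.nearScore σ N y (Δ N) S r α i} := measure_mono hsub
    _ ≤ ENNReal.ofReal ((K * α / δ) ^ ((A.card : ℝ) / 2)) := hN Φ A hA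
    _ ≤ ENNReal.ofReal (Real.exp (-(h * ((N : ℝ) + 1)))) :=
        ENNReal.ofReal_le_ofReal (ShareLD.rpow_half_card_le (by positivity) hδ hh.le hbase hA)

/-- **REGISTERED SUB-GOAL — the stub's tail from the directional large deviation, at every `(σ, θ)`:**
`NearSetLD σ θ` gives, for all `δ, h > 0`, an `η₀ > 0` such that `ShareLDAt σ θ δ h η Φ` holds for `0 < η < η₀` and every
flow family `Φ` (composition with the landed `shareLD_of_shareSetLD`). So `stub_oneFlightShareLD` follows from
`∃ σ₀ > 0, ∀ σ ∈ (0, σ₀), ∀ θ > 0, ShareLD.NearSetLD σ θ`. [folklore] -/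
theorem shareLDAt_of_nearSetLD : ∀ σ θ : ℝ, ShareLD.NearSetLD σ θ → ∀ δ h : ℝ, 0 < δ → 0 < h → ∃ η₀ : ℝ, 0 < η₀ ∧ ∀ η : ℝ, 0 < η → η < η₀ → ∀ Φ : (N : ℕ) → Flow σ N, ShareLDAt σ θ δ h η Φ :=
  fun σ θ H => shareLD_of_shareSetLD σ θ (shareSetLD_of_nearSetLD σ θ H)

end

end Summit.AtomisticToContinuum.HydrodynamicLimit.Theorems.DiffuseBackwardInfluenceShare
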